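import Summits.CriticalPhenomena.CardyFormulaZ2.Theorems.CardyBoundaryCoulombGasStripClusterRatesConfinedGlueTransfer
import Summits.CriticalPhenomena.CardyFormulaZ2.Theorems.CardyBoundaryCoulombGasStripClusterRatesConfinedBandLower
import Summits.CriticalPhenomena.CardyFormulaZ2.Theorems.CardyBoundaryCoulombGasStripClusterRatesTwoClusterUniformBounds
import Summits.CriticalPhenomena.CardyFormulaZ2.Theorems.CardyBoundaryCoulombGasStripRatesExist
import HarnessLib

/-!
# A-priori Cardy-order lower bound for the end-confined block event (stub `c8_confined_apriori_lower`)

Support file for line `two-cluster-rate-is-stationary-gap` (crux `StripClusterRates`,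
stmt-CriticalPhenomena-13878), lead c8, stub T7. For the probability `f(M,b)` of the end-confined block
event `F(M,b)` of the confined-gluing order transfer on `R = [0,M]×[0,3b+2]` we prove the a-priori
Cardy-order lower bound, uniform in the mesh `b ≥ 2`,

  `exp(-C·A) ≤ f(A(3b+2), b)`   (`A ≥ 1`, `b ≥ 2`, `C = 322 log 2`),

the confined analogue of the RSW lower bound for long rectangles. Proof: the band lower bound
`p₁(M,b)·p₁(M,b)·p₁(M+1,b-1) ≤ 4 f(M,b)` (`c8_confined_band_lower`, three row-disjoint bands) and, for each
factor, the finite-length rate bound `p₁(m,w) ≥ exp(-γ₁(w)(m+1))` (`rateOne_ge_finite`) together with RSW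
at every width `γ₁(w) ≤ 16 log 2/w` (`rateOne_le_width`); with `M = A(3b+2)` the exponents are
`≤ 16 log 2·(4A+1)` (twice) and `≤ 16 log 2·(8A+2)`, and the constants are absorbed using `A ≥ 1`.

References: M. Aizenman, Nucl. Phys. B 485 (1997), Thm 3 (alternating bands) [Aizenman1997];
B. Bollobás, O. Riordan, *Percolation* (2006), Ch. 3 [BollobasRiordan2006].
-/

noncomputable section

open MeasureTheory Filter Topology Set
open Literature.Probability.LatticeModels Literature.Probability.Percolation
open Summit.CriticalPhenomena.CardyFormulaZ2.Theorems.StripClusterRates.Negative (pOne pTwo rateSeqTwo rateSeqOne)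

namespace Summit.CriticalPhenomena.CardyFormulaZ2.Cruxes.StripClusterRates.TwoClusterRateIsStationaryGap

open Summit.CriticalPhenomena.CardyFormulaZ2.Theorems.StripClusterRates.Negative

/-- **A one-cluster rate function at every width**: `-log p₁(m,n)/m → γ₁(n)` for all `n`
(super-multiplicativity of `p₁` by gluing and Fekete, `StripRates.exists_rateOne`). [folklore] -/
theorem cal_exists_rateOne_family :
    ∃ γ₁ : ℕ → ℝ, ∀ n : ℕ, 1 ≤ n → Tendsto (rateSeqOne n) atTop (𝓝 (γ₁ n)) := by
  choose γ hγ using Summit.CriticalPhenomena.CardyFormulaZ2.Theorems.StripRates.exists_rateOne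
  exact ⟨γ, fun n _ => hγ n⟩

/-- **Finite-length exponential lower bound**: if `-log p₁(m',n)/m' → γ` then
`exp(-γ(m+1)) ≤ p₁(m,n)` for every `m` (`rateOne_ge_finite`). [folklore] -/
theorem cal_pOne_ge_exp {n : ℕ} {γ : ℝ} (h : Tendsto (rateSeqOne n) atTop (𝓝 γ)) (m : ℕ) :
    Real.exp (-(γ * ((m : ℝ) + 1))) ≤ pOne m n := by
  have hp : 0 < pOne m n := lt_of_lt_of_le (by positivity) (pOne_ge m n)
  have h1 := rateOne_ge_finite h m
  have hm : (0 : ℝ) < (m : ℝ) + 1 := by positivity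
  rw [div_le_iff₀ hm] at h1
  rw [← Real.exp_log hp]
  exact Real.exp_le_exp.2 (by linarith)

/-- **RSW lower bound for `p₁` in terms of the aspect**: if `γ₁` is a one-cluster rate function,
`1 ≤ w` and `m + 1 ≤ L·w`, then `exp(-16 log 2 · L) ≤ p₁(m,w)` (`γ₁(w) ≤ 16 log 2/w`).
[cite: BollobasRiordan2006, Ch. 3, Cor. 3(iii)] -/
theorem cal_pOne_ge_aspect {γ₁ : ℕ → ℝ} (h₁ : ∀ n : ℕ, 1 ≤ n → Tendsto (rateSeqOne n) atTop (𝓝 (γ₁ n)))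
    {w m L : ℕ} (hw : 1 ≤ w) (hL : m + 1 ≤ L * w) :
    Real.exp (-(16 * Real.log 2 * (L : ℝ))) ≤ pOne m w := by
  refine le_trans (Real.exp_le_exp.2 ?_) (cal_pOne_ge_exp (h₁ w hw) m)
  have hγ := rateOne_le_width h₁ hw
  have hl : 0 < Real.log 2 := Real.log_pos one_lt_two
  have hw0 : (0 : ℝ) < w := Nat.cast_pos.2 hw
  have hm0 : (0 : ℝ) ≤ (m : ℝ) + 1 := by positivity
  have hcast : (m : ℝ) + 1 ≤ (L : ℝ) * w := by exact_mod_cast hL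
  have h2 : γ₁ w * ((m : ℝ) + 1) ≤ 16 * Real.log 2 / w * ((m : ℝ) + 1) :=
    mul_le_mul_of_nonneg_right hγ hm0
  have h3 : 16 * Real.log 2 / w * ((m : ℝ) + 1) ≤ 16 * Real.log 2 * L := by
    rw [div_mul_eq_mul_div, div_le_iff₀ hw0]
    have := mul_le_mul_of_nonneg_left hcast (mul_pos (by norm_num : (0 : ℝ) < 16) hl).le
    linarith
  linarith

/-- `exp(2 log 2) = 4`. [folklore] -/
theorem cal_exp_two_log_two : Real.exp (2 * Real.log 2) = 4 := by
  have : (2 : ℝ) * Real.log 2 = Real.log ((2 : ℝ) ^ 2) := by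
    rw [Real.log_pow]; norm_num
  rw [this, Real.exp_log (by norm_num)]
  norm_num

/-- **A-priori Cardy-order lower bound for the end-confined block event** (registered stub
`c8_confined_apriori_lower`, line `two-cluster-rate-is-stationary-gap`, lead c8): for the probability
`f(M,b)` of the end-confined block event `F(M,b)` on `[0,M]×[0,3b+2]` there is `C > 0` with
`exp(-C·A) ≤ f(A(3b+2), b)` for all `A ≥ 1`, `b ≥ 2` (here `C = 322 log 2`): the band lower bound
`p₁(M,b)² p₁(M+1,b-1) ≤ 4 f(M,b)` and, for each factor, `p₁(m,w) ≥ exp(-γ₁(w)(m+1))` with RSW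
`γ₁(w) ≤ 16 log 2/w`. [cite: Aizenman1997, Thm 3] -/
theorem c8_confined_apriori_lower : ∀ f : ℕ → ℕ → ℝ, f = (fun M b : ℕ => (bondPercolation (zdGraph 2) half).real ((openCrossing {z ∈ (rectangle M (3 * b + 2) : Set (Site 2)) | (z 0 ≤ (b : ℤ) ∨ (M : ℤ) ≤ z 0 + b) → z 1 ≤ (b : ℤ)} (leftSide M (3 * b + 2) : Set (Site 2)) (rightSide M (3 * b + 2) : Set (Site 2)) ∩ tbCrossing b b ∩ openCrossing {z ∈ (rectangle M (3 * b + 2) : Set (Site 2)) | (z 0 ≤ (b : ℤ) ∨ (M : ℤ) ≤ z 0 + b) → 2 * (b : ℤ) + 2 ≤ z 1} (leftSide M (3 * b + 2) : Set (Site 2)) (rightSide M (3 * b + 2) : Set (Site 2)) ∩ (BondConfig.relabel (sym2Equiv (Site.shift (-pt 0 (2 * (b : ℤ) + 2))))) ⁻¹' tbCrossing b b) ∩ (dualConfig ⁻¹' openCrossing {z ∈ ((· + pt (-1) 0) '' (rectangle (M + 1) (3 * b + 1) : Set (Site 2))) | (z 0 ≤ (b : ℤ) ∨ (M : ℤ)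 ≤ z 0 + b) → (b : ℤ) + 1 ≤ z 1 ∧ z 1 ≤ 2 * (b : ℤ)} ((· + pt (-1) 0) '' (leftSide (M + 1) (3 * b + 1) : Set (Site 2))) ((· + pt (-1) 0) '' (rightSide (M + 1) (3 * b + 1) : Set (Site 2)))))) → (∃ C : ℝ, 0 < C ∧ ∀ A b : ℕ, 1 ≤ A → 2 ≤ b → Real.exp (-(C * A)) ≤ f (A * (3 * b + 2)) b) := by
  intro f hf
  obtain ⟨γ₁, h₁⟩ := cal_exists_rateOne_family
  have hl : 0 < Real.log 2 := Real.log_pos one_lt_two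
  refine ⟨322 * Real.log 2, mul_pos (by norm_num) hl, fun A b hA hb => ?_⟩
  obtain ⟨c, rfl⟩ : ∃ c, b = c + 2 := ⟨b - 2, by omega⟩
  have hA' : (1 : ℝ) ≤ A := by exact_mod_cast hA
  have hM1 : 1 ≤ A * (3 * (c + 2) + 2) := Nat.succ_le_of_lt (Nat.mul_pos (by omega) (by omega))
  have hband := c8_confined_band_lower f hf (c + 2) (A * (3 * (c + 2) + 2)) (by omega) hM1
  -- the three factors
  have hL1 : A * (3 * (c + 2) + 2) + 1 ≤ (4 * A + 1) * (c + 2) := by nlinarith [Nat.zero_le (A * c)]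
  have hL2 : A * (3 * (c + 2) + 2) + 1 + 1 ≤ (8 * A + 2) * (c + 2 - 1) := by
    have e : c + 2 - 1 = c + 1 := by omega
    rw [e]
    nlinarith [Nat.zero_le (A * c), Nat.zero_le c]
  have hE1 := cal_pOne_ge_aspect h₁ (w := c + 2) (by omega) hL1
  have hE2 := cal_pOne_ge_aspect h₁ (w := c + 2 - 1) (by omega) hL2
  have hp0 : 0 ≤ pOne (A * (3 * (c + 2) + 2)) (c + 2) := (Real.exp_nonneg _).trans hE1
  have hprod := mul_le_mul (mul_le_mul hE1 hE1 (Real.exp_nonneg _) hp0) hE2 (Real.exp_nonneg _)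
    (mul_nonneg hp0 hp0)
  -- absorb the constants
  have hexp : Real.exp (-(322 * Real.log 2 * (A : ℝ))) * 4 ≤
      Real.exp (-(16 * Real.log 2 * ((4 * A + 1 : ℕ) : ℝ))) *
        Real.exp (-(16 * Real.log 2 * ((4 * A + 1 : ℕ) : ℝ))) *
        Real.exp (-(16 * Real.log 2 * ((8 * A + 2 : ℕ) : ℝ))) := by
    rw [← cal_exp_two_log_two]
    simp only [← Real.exp_add, Real.exp_le_exp]
    push_cast
    have hLA : Real.log 2 ≤ Real.log 2 * A := le_mul_of_one_le_right hl.le hA'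
    linarith
  linarith [hexp.trans (hprod.trans hband)]

end Summit.CriticalPhenomena.CardyFormulaZ2.Cruxes.StripClusterRates.TwoClusterRateIsStationaryGap

end
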